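import Literature.Geometry.Kaehler.ComplexTorusAnalyticCycleClassBoundedVolume
import Literature.Geometry.Kaehler.ComplexTorusAnalyticCycleClassNonzero
import Literature.Geometry.Kaehler.LelongVolumeLowerBound
import HarnessLib

/-!
# Effective analytic cycles of bounded degree on a complex torus: a uniform lower volume bound and finiteness of the classes

Layer `Literature/Geometry/Kaehler`; lane `lit-hodgefound`, seat p07, programme «BOUNDED CYCLES ON A
COMPLEX TORUS», file 3. Let `X = E/Λ` (`Λ = Φ(ℤ^ι)`) be a complex torus with its flat Kähler form `ω`
(`kaehlerPow p = ω^p/p!`), and let the DEGREE of an analytic `p`-cycle `T = Σ k_j Z_j` of `X`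
(`HolomorphicChain 𝓘(ℂ, E) (ComplexTorus Φ) p`) be `deg T = ⟨ω^p/p!, cl(T)⟩ = Σ_j k_j vol(Z_j)`
(`ComplexTorus.chainCycleClass`, `poincarePairing_chainCycleClass`, Wirtinger
`analyticCyclePeriod_kaehlerPow_eq`: `vol(Z) = 𝓗^{2p}(Φ([0,1)^ι) ∩ reg π⁻¹Z)`).

* `ComplexTorus.exists_pos_le_measure_preimage_cover_inter_periodBox` — **a UNIFORM lower bound for
  the volume of analytic subsets**: there is `v > 0` with `v ≤ 𝓗^{2p}(π⁻¹Z ∩ Φ([0,1)^ι))` for EVERY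
  analytic `Z ⊆ X` of pure dimension `p` — Lelong's lower bound `𝓗^{2p}(π⁻¹Z ∩ B(a, 1)) ≥ c(2p)`
  [Chirka1989, §15.3 Thm.] at a lift `a ∈ Φ([0,1)^ι)` of a point of `Z`, and the unit ball around a point
  of the period box meets only boundedly many lattice translates of the box
  (`measure_preimage_cover_inter_le_of_isCompact`); real form `exists_pos_le_volume`;
* `ComplexTorus.re_poincarePairing_kaehlerPow_chainCycleClass_eq_sum` — `deg T = Σ_j k_j vol(Z_j)`;
  for an EFFECTIVE cycle (`k_j ≥ 0`): `volume_le_degree_of_mem_components` (`vol(Z_j) ≤ deg T`) and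
  `sum_toNat_mult_mul_le_degree` (`(Σ_j k_j) · v ≤ deg T`: the total multiplicity is bounded by
  `deg T / v`);
* `ComplexTorus.finite_chainCycleClass_of_degree_le` — **FINITENESS OF THE CLASSES OF EFFECTIVE
  ANALYTIC CYCLES OF BOUNDED DEGREE**: the classes `cl(T) ∈ H^k(X, ℂ)` of the effective analytic
  `p`-cycles `T` of `X` (`p = d + 1`) with `deg T ≤ M` form a finite set — each component has volume
  `≤ M`, so its class lies in the finite set of `ComplexTorusAnalyticCycleClassBoundedVolume.lean`
  ([Chirka1989, §16.1 Prop. 1; Fujiki1978, §2, §4]), and `cl(T) = Σ_s n_s s` over that set with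
  `0 ≤ n_s ≤ M / v` ([Fujiki1978, §4 Prop. 4.1: bounded subsets of the cycle space of a compact Kähler
  manifold]; for abelian varieties: the effective cycles of bounded degree have finitely many classes).

Theorems only; no new definitions, no named facts.

## References

* [Chirka1989] E. M. Chirka, *Complex Analytic Sets*, Kluwer 1989, §13.3 Cor., §15.3 Thm. (p. 194),
  §16.1 Prop. 1 (pp. 206–207).
* [Fujiki1978] A. Fujiki, *Closedness of the Douady spaces of compact Kähler spaces*, Publ. RIMS 14
  (1978) 1–52, Def. 1.1, §2 Prop. 2.10, §4 Prop. 4.1.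
* [VoisinHodgeI2002] C. Voisin, *Hodge Theory and Complex Algebraic Geometry I*, CUP 2002, §3.1.3,
  §11.1.2.
* [Lange2023AbelianVarietiesComplex] H. Lange, *Abelian Varieties over the Complex Numbers*, Springer
  2023, §1.1.1, §6.2.1.
* [Decataldo2007] M. A. de Cataldo, *The Hodge Theory of Projective Manifolds*, ICP 2007, Thm. 6.1.4.
-/

noncomputable section

open scoped Manifold ENNReal NNReal Topology
open MeasureTheory TopologicalSpace Set Function Filter Complex Metric
open Literature.Geometry.GeometricMeasureTheory

namespace Literature.Geometry.Kaehler

-- Nested operator-norm instances on `Covector V m` / `Multivector V m`, as in `Currents.lean`.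
set_option maxSynthPendingDepth 2

universe u

namespace ComplexTorus

/-! ## §1. A uniform lower bound for the volume of analytic subsets of the torus -/

section LowerBound

variable {ι : Type*} [Fintype ι] {E : Type u} [NormedAddCommGroup E] [InnerProductSpace ℂ E]
  (Φ : (ι → ℝ) ≃L[ℝ] E)

omit [Fintype ι] in
/-- Every point of `E` has a lattice translate in the period box `Φ([0,1)^ι)` (take the integer parts
of the coordinates). [cite: Lange2023AbelianVarietiesComplex, §1.1.1] -/
theorem exists_sub_latticeVec_mem_periodBox (x : E) : ∃ m : ι → ℤ, x - latticeVec Φ m ∈ periodBox Φ 0 := by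
  refine ⟨fun i ↦ ⌊Φ.symm x i⌋, ?_⟩
  rw [mem_periodBox_iff]
  intro i
  rw [map_sub, Pi.sub_apply, symm_latticeVec_apply, Pi.zero_apply, zero_add]
  exact ⟨by linarith [Int.floor_le (Φ.symm x i)], by linarith [Int.lt_floor_add_one (Φ.symm x i)]⟩

variable [FiniteDimensional ℂ E] [MeasurableSpace E] [BorelSpace E]

/-- **Uniform lower volume bound.** There is `v > 0` (finite) such that
`v ≤ 𝓗^{2p}(π⁻¹Z ∩ Φ([0,1)^ι))` for EVERY analytic subset `Z ⊆ X` of pure dimension `p`: at a lift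
`a ∈ Φ([0,1)^ι)` of a point of `Z`, Lelong's bound gives `𝓗^{2p}(π⁻¹Z ∩ B(a,1)) ≥ c(2p)`
[Chirka1989, §15.3 Thm.], while `B(a, 1)` lies in a fixed compact set covered by `N` lattice translates
of the box, each carrying the volume `𝓗^{2p}(π⁻¹Z ∩ Φ([0,1)^ι))` (periodicity).
[cite: Chirka1989, §15.3 Thm., p. 194; Lange2023AbelianVarietiesComplex, §1.1.1] -/
theorem exists_pos_le_measure_preimage_cover_inter_periodBox (p : ℕ) :
    ∃ v : ℝ≥0∞, 0 < v ∧ v < ⊤ ∧ ∀ (Z : Set (ComplexTorus Φ)), HasPureDim 𝓘(ℂ, E) Z p →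
      v ≤ (μHE[2 * p] : Measure E) (cover Φ ⁻¹' Z ∩ periodBox Φ 0) := by
  haveI : FiniteDimensional ℝ E := FiniteDimensional.complexToReal E
  -- a compact set containing the unit balls around the points of the period box
  obtain ⟨D, hD⟩ := isBounded_iff_forall_norm_le.1 (isCompact_closedPeriodBox Φ 0).isBounded
  set K₀ : Set E := closedBall (0 : E) (D + 1) with hK₀
  have hK₀c : IsCompact K₀ := isCompact_closedBall _ _
  have hballK₀ : ∀ x ∈ periodBox Φ 0, ball x 1 ⊆ K₀ := by
    intro x hx y hy
    rw [hK₀, mem_closedBall_zero_iff]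
    have hxD : ‖x‖ ≤ D := hD x (periodBox_subset_closedPeriodBox Φ 0 hx)
    have hyx : ‖y - x‖ < 1 := by rwa [mem_ball_iff_norm] at hy
    calc ‖y‖ = ‖(y - x) + x‖ := by rw [sub_add_cancel]
      _ ≤ ‖y - x‖ + ‖x‖ := norm_add_le _ _
      _ ≤ D + 1 := by linarith
  obtain ⟨N, hN⟩ := measure_preimage_cover_inter_le_of_isCompact Φ (2 * p) hK₀c
  set c : ℝ≥0∞ := unitBallVolume (2 * p) with hc
  have hc0 : c ≠ 0 := (unitBallVolume_ne_zero_ne_top (2 * p)).1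
  refine ⟨min (c / N) 1, lt_min (ENNReal.div_pos hc0 (ENNReal.natCast_ne_top N)) one_pos,
    (min_le_right _ _).trans_lt ENNReal.one_lt_top, fun Z hZ ↦ (min_le_left _ _).trans ?_⟩
  -- a lift in the period box of a point of `Z`
  obtain ⟨z, hz⟩ := hZ.nonempty
  obtain ⟨x₀, rfl⟩ := cover_surjective Φ z
  obtain ⟨m, hm⟩ := exists_sub_latticeVec_mem_periodBox Φ x₀
  set x : E := x₀ - latticeVec Φ m with hx
  have hxZ : cover Φ x ∈ Z := by rwa [hx, cover_sub_latticeVec]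
  -- Lelong's lower bound at `x`, radius `1`
  have hlel := unitBallVolume_mul_le_measure_inter_ball (hasPureDim_liftSet Φ hZ)
    (a := (⟨x, trivial⟩ : (⊤ : Opens E))) hxZ one_pos (fun _ _ ↦ trivial)
  rw [one_pow, ENNReal.ofReal_one, mul_one, image_val_liftSet] at hlel
  -- `c ≤ 𝓗(π⁻¹Z ∩ B(x,1)) ≤ 𝓗(π⁻¹Z ∩ K₀) ≤ N 𝓗(π⁻¹Z ∩ box)`
  have hle : c ≤ N * (μHE[2 * p] : Measure E) (cover Φ ⁻¹' Z ∩ periodBox Φ 0) :=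
    hlel.trans ((measure_mono (inter_subset_inter_right _ (hballK₀ x hm))).trans (hN Z))
  rw [mul_comm] at hle
  exact ENNReal.div_le_of_le_mul hle

/-- **Uniform lower bound for `vol(Z) = 𝓗^{2p}(Φ([0,1)^ι) ∩ reg π⁻¹Z) = ∫_Z ω^p/p!`** (real form): there
is `v > 0` with `v ≤ vol(Z)` for every analytic `Z ⊆ X` of pure dimension `p`.
[cite: Chirka1989, §15.3 Thm., p. 194; VoisinHodgeI2002, §3.1.3] -/
theorem exists_pos_le_volume (p : ℕ) :
    ∃ v : ℝ, 0 < v ∧ ∀ (Z : Set (ComplexTorus Φ)) (hZ : HasPureDim 𝓘(ℂ, E) Z p),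
      v ≤ (μHE[2 * p] : Measure E).real (periodBox Φ 0 ∩ (analyticChain Φ hZ).carrier) := by
  obtain ⟨v, hv0, hvt, hv⟩ := exists_pos_le_measure_preimage_cover_inter_periodBox Φ p
  refine ⟨v.toReal, ENNReal.toReal_pos hv0.ne' hvt.ne, fun Z hZ ↦ ?_⟩
  have heq : (μHE[2 * p] : Measure E) (cover Φ ⁻¹' Z ∩ periodBox Φ 0) =
      (μHE[2 * p] : Measure E) (periodBox Φ 0 ∩ (analyticChain Φ hZ).carrier) := by
    rw [← image_val_liftSet, analyticChain,
      HolomorphicChain.measure_image_inter_eq_carrier_inter (hasPureDim_liftSet Φ hZ), inter_comm]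
  exact ENNReal.toReal_mono (measure_periodBox_inter_carrier_lt_top Φ hZ 0).ne (heq ▸ hv Z hZ)

end LowerBound

/-! ## §2. The degree of an effective cycle controls its components and multiplicities -/

section Degree

variable {ι : Type*} [Fintype ι] [DecidableEq ι] {E : Type u} [NormedAddCommGroup E]
  [InnerProductSpace ℂ E] [FiniteDimensional ℂ E] [MeasurableSpace E] [BorelSpace E]
  (Φ : (ι → ℝ) ≃L[ℝ] E) {n k d : ℕ} (e : Fin n ≃ ι) (h : 2 * d + k = n)

/-- `Re ⟨ω^d/d!, setCycleClass Z⟩ = vol(Z)` for a pure `d`-dimensional analytic `Z`.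
[cite: Chirka1989, §13.3 Corollary and §14.1] -/
theorem re_poincarePairing_kaehlerPow_setCycleClass {Z : Set (ComplexTorus Φ)}
    (hZ : HasPureDim 𝓘(ℂ, E) Z d) :
    (poincarePairing Φ e h (ofRealCLM.compContinuousAlternatingMap (kaehlerPow d))
        (setCycleClass Φ e h Z)).re =
      (μHE[2 * d] : Measure E).real (periodBox Φ 0 ∩ (analyticChain Φ hZ).carrier) := by
  rw [poincarePairing_setCycleClass Φ e h hZ, analyticCyclePeriod_kaehlerPow_eq Φ Z hZ 0, ofReal_re]

/-- **`deg T = Σ_j k_j vol(Z_j)`**: the degree `Re ⟨ω^d/d!, cl(T)⟩` of an analytic `d`-cycle is the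
multiplicity-weighted sum of the pairings of its components. [cite: VoisinHodgeI2002, §11.1.2 Cor. 11.15; Chirka1989, §13.3 Cor.] -/
theorem re_poincarePairing_kaehlerPow_chainCycleClass_eq_sum (T : HolomorphicChain 𝓘(ℂ, E) (ComplexTorus Φ) d) :
    (poincarePairing Φ e h (ofRealCLM.compContinuousAlternatingMap (kaehlerPow d))
        (chainCycleClass Φ e h T)).re =
      ∑ Z ∈ T.finite_components_of_compactSpace.toFinset, (T.mult Z : ℝ) *
        (poincarePairing Φ e h (ofRealCLM.compContinuousAlternatingMap (kaehlerPow d))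
          (setCycleClass Φ e h Z)).re := by
  rw [poincarePairing_chainCycleClass, Complex.re_sum]
  refine Finset.sum_congr rfl fun Z _ ↦ ?_
  rw [← ofReal_intCast, re_ofReal_mul]

variable {T : HolomorphicChain 𝓘(ℂ, E) (ComplexTorus Φ) d}

/-- For an EFFECTIVE cycle every term `k_Z vol(Z)` of the degree is non-negative.
[cite: VoisinHodgeI2002, §3.1.3 (Wirtinger)] -/
theorem mult_mul_re_poincarePairing_kaehlerPow_nonneg (hT : ∀ Z, 0 ≤ T.mult Z) (Z : Set (ComplexTorus Φ)) :
    0 ≤ (T.mult Z : ℝ) * (poincarePairing Φ e h (ofRealCLM.compContinuousAlternatingMap (kaehlerPow d))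
      (setCycleClass Φ e h Z)).re := by
  refine mul_nonneg (by exact_mod_cast hT Z) ?_
  by_cases hZ : HasPureDim 𝓘(ℂ, E) Z d
  · rw [re_poincarePairing_kaehlerPow_setCycleClass Φ e h hZ]
    exact ENNReal.toReal_nonneg
  · rw [setCycleClass, dif_neg hZ, map_zero, zero_re]

/-- **`vol(Z) ≤ deg T` for every component `Z` of an effective cycle `T`** (its multiplicity is `≥ 1`
and the other terms are `≥ 0`). [cite: Fujiki1978, Def. 1.1 and §4 Prop. 4.1] -/
theorem volume_le_degree_of_mem_components (hT : ∀ Z, 0 ≤ T.mult Z) {Z : Set (ComplexTorus Φ)}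
    (hZ : T.mult Z ≠ 0) :
    (μHE[2 * d] : Measure E).real (periodBox Φ 0 ∩ (analyticChain Φ (T.hasPureDim_of_mult_ne_zero hZ)).carrier) ≤
      (poincarePairing Φ e h (ofRealCLM.compContinuousAlternatingMap (kaehlerPow d))
        (chainCycleClass Φ e h T)).re := by
  have hmem : Z ∈ T.finite_components_of_compactSpace.toFinset :=
    T.finite_components_of_compactSpace.mem_toFinset.2 hZ
  have h1 : (1 : ℝ) ≤ T.mult Z := by exact_mod_cast lt_of_le_of_ne (hT Z) (Ne.symm hZ)
  rw [re_poincarePairing_kaehlerPow_chainCycleClass_eq_sum]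
  refine le_trans ?_ (Finset.single_le_sum (fun Z' _ ↦
    mult_mul_re_poincarePairing_kaehlerPow_nonneg Φ e h hT Z') hmem)
  rw [re_poincarePairing_kaehlerPow_setCycleClass Φ e h (T.hasPureDim_of_mult_ne_zero hZ)]
  exact le_mul_of_one_le_left ENNReal.toReal_nonneg h1

/-- **The total multiplicity of an effective cycle is bounded by its degree**: if `v > 0` is a lower
bound for the volumes of the pure `d`-dimensional analytic subsets of `X` (`exists_pos_le_volume`),
then `(Σ_j k_j) · v ≤ deg T`. [cite: Fujiki1978, §4 Prop. 4.1; Chirka1989, §15.3 Thm.] -/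
theorem sum_toNat_mult_mul_le_degree (hT : ∀ Z, 0 ≤ T.mult Z) {v : ℝ}
    (hv : ∀ (Z : Set (ComplexTorus Φ)) (hZ : HasPureDim 𝓘(ℂ, E) Z d),
      v ≤ (μHE[2 * d] : Measure E).real (periodBox Φ 0 ∩ (analyticChain Φ hZ).carrier)) :
    (∑ Z ∈ T.finite_components_of_compactSpace.toFinset, (T.mult Z).toNat : ℕ) * v ≤
      (poincarePairing Φ e h (ofRealCLM.compContinuousAlternatingMap (kaehlerPow d))
        (chainCycleClass Φ e h T)).re := by
  rw [re_poincarePairing_kaehlerPow_chainCycleClass_eq_sum, Nat.cast_sum, Finset.sum_mul]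
  refine Finset.sum_le_sum fun Z hZ ↦ ?_
  have hZ0 : T.mult Z ≠ 0 := T.finite_components_of_compactSpace.mem_toFinset.1 hZ
  have hcast : ((T.mult Z).toNat : ℝ) = (T.mult Z : ℝ) := by
    rw [← Int.cast_natCast, Int.toNat_of_nonneg (hT Z)]
  rw [hcast, re_poincarePairing_kaehlerPow_setCycleClass Φ e h (T.hasPureDim_of_mult_ne_zero hZ0)]
  exact mul_le_mul_of_nonneg_left (hv Z _) (by exact_mod_cast hT Z)

end Degree

/-! ## §3. Finiteness of the classes of effective cycles of bounded degree -/

section Finiteness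

variable {ι : Type*} [Fintype ι] [DecidableEq ι] {E : Type u} [NormedAddCommGroup E]
  [InnerProductSpace ℂ E] [FiniteDimensional ℂ E] [MeasurableSpace E] [BorelSpace E]
  (Φ : (ι → ℝ) ≃L[ℝ] E) {n k d : ℕ} (e : Fin n ≃ ι) (h : 2 * (d + 1) + k = n)

/-- **FINITENESS OF THE CLASSES OF EFFECTIVE ANALYTIC CYCLES OF BOUNDED DEGREE.** The classes
`cl(T) ∈ H^k(X, ℂ)` of the effective analytic `p`-cycles `T = Σ k_j Z_j` (`k_j ≥ 0`, `p = d + 1`) of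
the complex torus `X = E/Λ` with `deg T = ⟨ω^p/p!, cl(T)⟩ = Σ k_j vol(Z_j) ≤ M` form a finite set:
every component has `vol(Z_j) ≤ M`, so `[Z_j]` lies in the finite set `S` of classes of analytic subsets
of volume `≤ M` (`finite_analyticCycleClass_of_volume_le`), and `cl(T) = Σ_{s ∈ S} n_s s` with
`0 ≤ n_s ≤ Σ_j k_j ≤ M / v`, `v` the uniform lower volume bound.
[cite: Fujiki1978, §4 Prop. 4.1 and §2 Prop. 2.10; Chirka1989, §15.3 Thm. and §16.1 Prop. 1] -/
theorem finite_chainCycleClass_of_degree_le (M : ℝ) :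
    {c : E [⋀^Fin k]→L[ℝ] ℂ | ∃ T : HolomorphicChain 𝓘(ℂ, E) (ComplexTorus Φ) (d + 1),
      (∀ Z, 0 ≤ T.mult Z) ∧
      (poincarePairing Φ e h (ofRealCLM.compContinuousAlternatingMap (kaehlerPow (d + 1)))
        (chainCycleClass Φ e h T)).re ≤ M ∧ chainCycleClass Φ e h T = c}.Finite := by
  classical
  -- the finite set of classes of analytic subsets of volume `≤ M`, as a finset
  have hS := finite_analyticCycleClass_of_volume_le Φ e h (d := d) M
  set S : Finset (E [⋀^Fin k]→L[ℝ] ℂ) := hS.toFinset with hSdef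
  -- the uniform lower volume bound and the bound on the total multiplicity
  obtain ⟨v, hv0, hv⟩ := exists_pos_le_volume Φ (d + 1)
  set B : ℕ := ⌊M / v⌋₊ with hB
  -- every class in question is `Σ_{s ∈ S} n_s • s` with `n : S → {0, …, B}`
  refine (Set.finite_range (fun ν : S → Fin (B + 1) ↦ ∑ s : S, ((ν s : ℕ) : ℤ) • (s : E [⋀^Fin k]→L[ℝ] ℂ))).subset
    ?_
  rintro c ⟨T, hT, hdeg, rfl⟩
  set F := T.finite_components_of_compactSpace.toFinset with hF
  set cls : Set (ComplexTorus Φ) → E [⋀^Fin k]→L[ℝ] ℂ := fun Z ↦ setCycleClass Φ e h Z with hcls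
  -- components have pure dimension, volume `≤ M`, hence class in `S`
  have hmemS : ∀ Z ∈ F, cls Z ∈ S := by
    intro Z hZ
    have hZ0 : T.mult Z ≠ 0 := T.finite_components_of_compactSpace.mem_toFinset.1 hZ
    have hZd := T.hasPureDim_of_mult_ne_zero hZ0
    rw [hSdef, Set.Finite.mem_toFinset]
    exact ⟨Z, hZd, (volume_le_degree_of_mem_components Φ e h hT hZ0).trans hdeg,
      (setCycleClass_of_hasPureDim Φ e h hZd).symm⟩
  -- total multiplicity `L ≤ B`
  set L : ℕ := ∑ Z ∈ F, (T.mult Z).toNat with hL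
  have hLB : L ≤ B := by
    have h1 : (L : ℝ) * v ≤ M := (sum_toNat_mult_mul_le_degree Φ e h hT hv).trans hdeg
    exact Nat.le_floor ((le_div_iff₀ hv0).2 h1)
  -- the multiplicity function on `S`
  set ν : S → Fin (B + 1) := fun s ↦
    ⟨∑ Z ∈ F with cls Z = s, (T.mult Z).toNat, Nat.lt_succ_of_le
      ((Finset.sum_le_sum_of_subset (Finset.filter_subset _ F)).trans hLB)⟩ with hν
  refine ⟨ν, ?_⟩
  -- `Σ_s ν_s • s = Σ_{Z ∈ F} k_Z • cls Z = cl(T)`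
  have hcl : chainCycleClass Φ e h T = ∑ Z ∈ F, T.mult Z • cls Z := rfl
  rw [hcl, ← Finset.sum_fiberwise_of_maps_to hmemS, ← Finset.sum_coe_sort S]
  refine Finset.sum_congr rfl fun s _ ↦ ?_
  simp only [hν, Nat.cast_sum]
  rw [Finset.sum_smul]
  refine Finset.sum_congr rfl fun Z hZ ↦ ?_
  rw [Finset.mem_filter] at hZ
  rw [hZ.2, Int.toNat_of_nonneg (hT Z)]

end Finiteness

end ComplexTorus

end Literature.Geometry.Kaehler

end
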